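import Mathlib.Algebra.BigOperators.Ring.Finset
import Summits.CriticalPhenomena.PercolationContinuityZ3.Theorems.PercNearOneGluingNoHeavyLowerTailAntiBandBlockCount

/-!
# `NoHeavyLowerTail` (crux stmt-CriticalPhenomena-4575), lane prim-ineq-gen-4 (gen 27): the two-set block sum

Support file (`--supports stmt-CriticalPhenomena-4575`; memo `run/shared/lean/prim/prim-ineq-gen-4/FINDING-OFFDIAG-UNIVERSAL-g27.md` §7(d), step (i)).
No definitions, no `sorry`, standard axioms.  Continues `AntiBandBlockCount` (peel lemma, four-block count).

-/
/-!
## Second part (gen 27): the two-set block sum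

For finsets `a, b` of a fintype and any weight `F`, the sum of `F (#(w ∩ a)) (#(w ∩ b))` over all `j`-subsets `w` is an explicit finite sum over block profiles
`(p₁, p₂, p₃, p₄)` (`pᵢ = #(w ∩ Pᵢ)` for the blocks `P = (a ∩ b, a \ b, b \ a, (a ∪ b)ᶜ)`, `Σ pᵢ = j`) with multiplicities `∏ C(#Pᵢ, pᵢ)`
(`sum_powersetCard_card_inter_eq_sum_blocks`).  This is the form in which a type-free Gram identity `Σ_w g(#(w∩a)) g'(#(w∩b)) = f(#a, #b, #(a∩b))` becomes a
`norm_num` computation per class (memo §7(d)).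
-/

namespace Summit.CriticalPhenomena.PercolationContinuityZ3.Theorems.AntiBandBlockCount

open Finset

variable {β : Type*} [DecidableEq β]

/-- A finset splits along `a ∩ b`, `a \ b`, `b \ a`, `(a ∪ b)ᶜ`: the four traces are counted by `#w`. [elementary] -/
theorem card_eq_sum_four_blocks [Fintype β] (a b w : Finset β) :
    #(w ∩ (a ∩ b)) + #(w ∩ (a \ b)) + #(w ∩ (b \ a)) + #(w ∩ (a ∪ b)ᶜ) = #w := by
  have h1 : #(w ∩ (a \ b)) + #(w ∩ (a ∩ b)) = #(w ∩ a) := by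
    rw [← Finset.inter_sdiff_assoc, ← inter_assoc]
    exact Finset.card_sdiff_add_card_inter (w ∩ a) b
  have h2 : #((w ∩ (a ∪ b)) \ a) + #((w ∩ (a ∪ b)) ∩ a) = #(w ∩ (a ∪ b)) := Finset.card_sdiff_add_card_inter _ _
  have h2a : (w ∩ (a ∪ b)) \ a = w ∩ (b \ a) := by
    ext x; simp only [mem_sdiff, mem_inter, mem_union]; tauto
  have h2b : (w ∩ (a ∪ b)) ∩ a = w ∩ a := by
    ext x; simp only [mem_inter, mem_union]; tauto
  rw [h2a, h2b] at h2
  have h3 : #(w \ (a ∪ b)) + #(w ∩ (a ∪ b)) = #w := Finset.card_sdiff_add_card_inter _ _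
  rw [Finset.sdiff_eq_inter_compl] at h3
  omega

/-- Trace counts: `#(w ∩ a) = #(w ∩ (a ∩ b)) + #(w ∩ (a \ b))` and `#(w ∩ b) = #(w ∩ (a ∩ b)) + #(w ∩ (b \ a))`. [elementary] -/
theorem card_inter_eq_blocks (a b w : Finset β) :
    #(w ∩ a) = #(w ∩ (a ∩ b)) + #(w ∩ (a \ b)) ∧ #(w ∩ b) = #(w ∩ (a ∩ b)) + #(w ∩ (b \ a)) := by
  constructor
  · have h1 : #(w ∩ (a \ b)) + #(w ∩ (a ∩ b)) = #(w ∩ a) := by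
      rw [← Finset.inter_sdiff_assoc, ← inter_assoc]
      exact Finset.card_sdiff_add_card_inter (w ∩ a) b
    omega
  · have h1 : #(w ∩ (b \ a)) + #(w ∩ (b ∩ a)) = #(w ∩ b) := by
      rw [← Finset.inter_sdiff_assoc, ← inter_assoc]
      exact Finset.card_sdiff_add_card_inter (w ∩ b) a
    rw [inter_comm b a] at h1
    omega

/-- **Two-set block sum.**  For finsets `a, b` of a fintype `β`, `j : ℕ` and any weight `F : ℕ → ℕ → ℚ`:
`∑_{w ⊆ β, #w = j} F(#(w ∩ a), #(w ∩ b)) = ∑_{p₁+p₂+p₃+p₄ = j} C(#(a∩b),p₁) C(#(a\b),p₂) C(#(b\a),p₃) C(#((a∪b)ᶜ),p₄) · F(p₁+p₂, p₁+p₃)`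
(`F` with values in any commutative semiring; the profile `p` ranges over `(range (j+1))⁴` filtered by the sum condition). [gen 27; `card_filter_powerset_four_blocks` fibrewise] -/
theorem sum_powersetCard_card_inter_eq_sum_blocks {R : Type*} [CommSemiring R] [Fintype β] (a b : Finset β) (j : ℕ) (F : ℕ → ℕ → R) :
    ∑ w ∈ (univ : Finset β).powersetCard j, F #(w ∩ a) #(w ∩ b)
      = ∑ p ∈ ((range (j + 1) ×ˢ range (j + 1)) ×ˢ (range (j + 1) ×ˢ range (j + 1))).filter
            (fun p => p.1.1 + p.1.2 + p.2.1 + p.2.2 = j),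
          (((#(a ∩ b)).choose p.1.1 * (#(a \ b)).choose p.1.2 * (#(b \ a)).choose p.2.1 * (#((a ∪ b)ᶜ)).choose p.2.2 : ℕ) : R)
            * F (p.1.1 + p.1.2) (p.1.1 + p.2.1) := by
  classical
  set S := (univ : Finset β).powersetCard j with hSdef
  set T := ((range (j + 1) ×ˢ range (j + 1)) ×ˢ (range (j + 1) ×ˢ range (j + 1))).filter
            (fun p : (ℕ × ℕ) × (ℕ × ℕ) => p.1.1 + p.1.2 + p.2.1 + p.2.2 = j) with hTdef
  set P₁ := a ∩ b with hP1
  set P₂ := a \ b with hP2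
  set P₃ := b \ a with hP3
  set P₄ := (a ∪ b)ᶜ with hP4
  set prof : Finset β → (ℕ × ℕ) × (ℕ × ℕ) := fun w => ((#(w ∩ P₁), #(w ∩ P₂)), (#(w ∩ P₃), #(w ∩ P₄))) with hprof
  set G : (ℕ × ℕ) × (ℕ × ℕ) → R := fun p => F (p.1.1 + p.1.2) (p.1.1 + p.2.1) with hGdef
  -- pairwise disjointness and covering of the blocks
  have h12 : Disjoint P₁ P₂ := (Finset.disjoint_sdiff_inter a b).symm
  have h13 : Disjoint P₁ P₃ := by rw [hP1, inter_comm]; exact (Finset.disjoint_sdiff_inter b a).symm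
  have hP1sub : P₁ ⊆ a ∪ b := inter_subset_left.trans subset_union_left
  have hP2sub : P₂ ⊆ a ∪ b := sdiff_subset.trans subset_union_left
  have hP3sub : P₃ ⊆ a ∪ b := sdiff_subset.trans subset_union_right
  have h14 : Disjoint P₁ P₄ := disjoint_compl_right_iff.mpr hP1sub
  have h23 : Disjoint P₂ P₃ := disjoint_sdiff_sdiff
  have h24 : Disjoint P₂ P₄ := disjoint_compl_right_iff.mpr hP2sub
  have h34 : Disjoint P₃ P₄ := disjoint_compl_right_iff.mpr hP3sub
  have hcover : P₁ ∪ P₂ ∪ P₃ ∪ P₄ = univ := by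
    ext x; simp only [hP1, hP2, hP3, hP4, mem_union, mem_inter, mem_sdiff, mem_compl, mem_univ, iff_true]; tauto
  -- the summand depends on `w` only through its profile
  have hF : ∀ w ∈ S, F #(w ∩ a) #(w ∩ b) = G (prof w) := by
    intro w _
    obtain ⟨h1, h2⟩ := card_inter_eq_blocks a b w
    simp only [hGdef, hprof, hP1, hP2, hP3, h1, h2]
  have hmaps : ∀ w ∈ S, prof w ∈ T := by
    intro w hw
    rw [hSdef, mem_powersetCard] at hw
    have hsum := card_eq_sum_four_blocks a b w
    rw [hw.2, ← hP1, ← hP2, ← hP3, ← hP4] at hsum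
    have b1 : #(w ∩ P₁) ≤ j := by rw [← hsum]; omega
    have b2 : #(w ∩ P₂) ≤ j := by rw [← hsum]; omega
    have b3 : #(w ∩ P₃) ≤ j := by rw [← hsum]; omega
    have b4 : #(w ∩ P₄) ≤ j := by rw [← hsum]; omega
    rw [hTdef, mem_filter]
    refine ⟨?_, hsum⟩
    simp only [hprof, mem_product, mem_range]
    exact ⟨⟨by omega, by omega⟩, by omega, by omega⟩
  rw [Finset.sum_congr rfl hF, ← Finset.sum_fiberwise_of_maps_to' hmaps G]
  apply Finset.sum_congr rfl
  intro p hp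
  rw [Finset.sum_const, nsmul_eq_mul]
  congr 1
  -- the fibre over `p` is the four-block set
  rw [hTdef, mem_filter] at hp
  have hfib : S.filter (fun w => prof w = p)
      = (P₁ ∪ P₂ ∪ P₃ ∪ P₄).powerset.filter (fun w => #(w ∩ P₁) = p.1.1 ∧ #(w ∩ P₂) = p.1.2 ∧ #(w ∩ P₃) = p.2.1 ∧ #(w ∩ P₄) = p.2.2) := by
    ext w
    rw [mem_filter, mem_filter, mem_powerset, hcover, hSdef, mem_powersetCard]
    constructor
    · rintro ⟨⟨hwu, _⟩, hpw⟩
      refine ⟨hwu, ?_⟩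
      rw [← hpw]
      exact ⟨rfl, rfl, rfl, rfl⟩
    · rintro ⟨hwu, c1, c2, c3, c4⟩
      have hsum := card_eq_sum_four_blocks a b w
      rw [← hP1, ← hP2, ← hP3, ← hP4] at hsum
      refine ⟨⟨hwu, ?_⟩, ?_⟩
      · rw [← hsum, c1, c2, c3, c4]; exact hp.2
      · simp only [hprof, c1, c2, c3, c4]
  rw [hfib, card_filter_powerset_four_blocks P₁ P₂ P₃ P₄ h12 h13 h14 h23 h24 h34]

end Summit.CriticalPhenomena.PercolationContinuityZ3.Theorems.AntiBandBlockCount
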